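import Summits.AtomisticToContinuum.FouriersLaw.Theses.OddSectorIrreversibility
import Literature.MathematicalPhysics.KineticTheory.OddSectorLocalityHypothesis
import Summits.AtomisticToContinuum.FouriersLaw.Theorems.OddSectorIrreversibilityConeScaleCorrectorStubCorrectorWitnessBoundOfCruxes

/-!
# `ConeScaleCorrector` (E1) — skeleton of line `Sketch` (card memory-time-bootstrap, ideator 2 / gen 2)

Crux item stmt-AtomisticToContinuum-14069, route decl
`Summit.AtomisticToContinuum.FouriersLaw.Theses.OddSectorIrreversibility.ConeScaleCorrector`.
Lead prover-line-stmt-AtomisticToContinuum-14069-a1-0 (re-seat a1, second line after GlueInnerCone died);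
RESHAPED by continuation lead c3 (2026-08-17): the witness jaw (W′) is no longer a stub — it is PROVED from
the two EXISTING sibling cruxes `P = TapLeakBound` (stmt-15159) and `E2 = SubBallisticWindow` (stmt-14070) by
the landed `stub_correctorWitnessBound_of_cruxes` (Theorems/…StubCorrectorWitnessBoundOfCruxes.lean, a
corollary of `response_bound_of_tapLeak` with `C₁ := ∫u²/(N²Z)`), so the registered stubs are now
{`stub_memoryTimeBound` (M), `stub_tapLeakBound` (= the item TapLeakBound verbatim), `stub_subBallisticWindow`
(= the item SubBallisticWindow verbatim)}: E1 ⟸ (M) ∧ P ∧ E2 by name, (M) the only stub that is not an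
existing item of the route.
The composition is the ideator's kernel-checked `bootstrapGlue` (`SketchIdeator2G2.lean`): the memory-time
bound (M) and the corrector-level witness bound (W) give E1 through the quadratic inequality
`x² ≤ a x + b ⇒ x² ≤ a² + 2b`. Registered stubs (sorries ONLY here), stated over Literature declarations:
* `stub_memoryTimeBound` (M, N-uniform, hardest): `∫u² dμ_T ≤ A·N·∫u·J_tot dμ_T + B·N²·Z`.
* `stub_tapLeakBound` (P = the sibling crux `TapLeakBound`, stmt-15159, verbatim) and
  `stub_subBallisticWindow` (E2 = the sibling crux `SubBallisticWindow`, stmt-14070, verbatim), from which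
  the former stub (W′) `stub_correctorWitnessBound` `∫u·J_tot dμ_T ≤ K₁‖u‖_{L²(μ_T)}√Z + K₂·N·Z` is now a
  THEOREM (`stub_correctorWitnessBound_of_cruxes`, landed).
Composition: `ConeScaleCorrector_of`.
-/

noncomputable section

open MeasureTheory Filter Topology Set
open scoped ENNReal NNReal
open Literature.MathematicalPhysics.KineticTheory.HeatConduction
open Literature.MathematicalPhysics.KineticTheory.OddSectorLocality

namespace Summit.AtomisticToContinuum.FouriersLaw.Theorems.OddSectorIrreversibility.MemoryTime

/-! ## Registered stubs -/

/-- **(M) `stub_memoryTimeBound`** (N-uniform, hardest; the relative form of E1: forecast memory time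
`‖u‖²/⟨u,J⟩ ≤ A·N` up to a cone budget `B N² Z`). -/
theorem stub_memoryTimeBound :
    ∀ ω₂ lam β γ : ℝ, 0 < ω₂ → 0 < lam → 0 < β → 0 < γ → ∀ T : ℝ, 0 < T → ∃ A B : ℝ, 0 ≤ A ∧
      ∀ (N : ℕ) (u : Literature.MathematicalPhysics.KineticTheory.HeatConduction.PhaseSpace N → ℝ),
      (∀ᵐ x ∂(Literature.MathematicalPhysics.KineticTheory.OddSectorLocality.gibbsWeight ω₂ lam β γ T N),
        Filter.Tendsto (fun τ : ℝ => ∫ t in Set.Ioc (0 : ℝ) τ,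
          Literature.MathematicalPhysics.KineticTheory.OddSectorLocality.currentForecast ω₂ lam β γ T N t x)
          Filter.atTop (nhds (u x))) →
      MeasureTheory.MemLp u 2 (Literature.MathematicalPhysics.KineticTheory.OddSectorLocality.gibbsWeight ω₂ lam β γ T N) ∧
      ∫ x, (u x) ^ 2 ∂(Literature.MathematicalPhysics.KineticTheory.OddSectorLocality.gibbsWeight ω₂ lam β γ T N) ≤
        A * (N : ℝ) * (∫ x, u x * (∑ i : Fin N,
            (Literature.MathematicalPhysics.KineticTheory.HeatConduction.pinnedChain ω₂ lam β γ).bondCurrent N i x)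
            ∂(Literature.MathematicalPhysics.KineticTheory.OddSectorLocality.gibbsWeight ω₂ lam β γ T N)) +
        B * (N : ℝ) ^ 2 * ∫ x, Real.exp
            (-((Literature.MathematicalPhysics.KineticTheory.HeatConduction.pinnedChain ω₂ lam β γ).hamiltonian N x) / T)
            ∂MeasureTheory.volume := by
  sorry

/-- **P `stub_tapLeakBound`** — the sibling crux `TapLeakBound` (item stmt-AtomisticToContinuum-15159) VERBATIM;
worked by its own line leads, never by a worker of this line. -/
theorem stub_tapLeakBound :
    Summit.AtomisticToContinuum.FouriersLaw.Theses.OddSectorIrreversibility.TapLeakBound := by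
  sorry

/-- **E2 `stub_subBallisticWindow`** — the sibling crux `SubBallisticWindow` (item stmt-AtomisticToContinuum-14070)
VERBATIM; worked by its own line leads, never by a worker of this line. -/
theorem stub_subBallisticWindow :
    Summit.AtomisticToContinuum.FouriersLaw.Theses.OddSectorIrreversibility.SubBallisticWindow := by
  sorry

/-- **(W′) `stub_correctorWitnessBound`** — NO LONGER A STUB (lead c3): the corrector-level witness bound
`∫u·J_tot dμ_T ≤ K₁·‖u‖_{L²(μ_T)}·√Z + K₂·N·Z` for every a.e.-limit corrector `u ∈ L²(μ_T)`, from P and E2 by the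
landed `stub_correctorWitnessBound_of_cruxes`. -/
theorem stub_correctorWitnessBound :
    ∀ ω₂ lam β γ : ℝ, 0 < ω₂ → 0 < lam → 0 < β → 0 < γ → ∀ T : ℝ, 0 < T → ∃ K₁ K₂ : ℝ,
      ∀ (N : ℕ) (u : Literature.MathematicalPhysics.KineticTheory.HeatConduction.PhaseSpace N → ℝ),
      (∀ᵐ x ∂(Literature.MathematicalPhysics.KineticTheory.OddSectorLocality.gibbsWeight ω₂ lam β γ T N),
        Filter.Tendsto (fun τ : ℝ => ∫ t in Set.Ioc (0 : ℝ) τ,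
          Literature.MathematicalPhysics.KineticTheory.OddSectorLocality.currentForecast ω₂ lam β γ T N t x)
          Filter.atTop (nhds (u x))) →
      MeasureTheory.MemLp u 2 (Literature.MathematicalPhysics.KineticTheory.OddSectorLocality.gibbsWeight ω₂ lam β γ T N) →
      ∫ x, u x * (∑ i : Fin N,
          (Literature.MathematicalPhysics.KineticTheory.HeatConduction.pinnedChain ω₂ lam β γ).bondCurrent N i x)
          ∂(Literature.MathematicalPhysics.KineticTheory.OddSectorLocality.gibbsWeight ω₂ lam β γ T N) ≤
        K₁ * Real.sqrt (∫ x, (u x) ^ 2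
            ∂(Literature.MathematicalPhysics.KineticTheory.OddSectorLocality.gibbsWeight ω₂ lam β γ T N)) *
          Real.sqrt (∫ x, Real.exp
            (-((Literature.MathematicalPhysics.KineticTheory.HeatConduction.pinnedChain ω₂ lam β γ).hamiltonian N x) / T)
            ∂MeasureTheory.volume) +
        K₂ * (N : ℝ) * ∫ x, Real.exp
            (-((Literature.MathematicalPhysics.KineticTheory.HeatConduction.pinnedChain ω₂ lam β γ).hamiltonian N x) / T)
            ∂MeasureTheory.volume :=
  Summit.AtomisticToContinuum.FouriersLaw.Theorems.OddSectorIrreversibility.stub_correctorWitnessBound_of_cruxes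
    stub_tapLeakBound stub_subBallisticWindow

/-! ## Vocabulary and glue of the card (the ideator's abbreviations; `bootstrapGlue` PROVED) -/

/-- unnormalised Gibbs weight `e^{−H_N/T} dq dp` of the chain `P` (as in the crux). -/
def gibbsW (P : OscillatorChain) (N : ℕ) (T : ℝ) : Measure (PhaseSpace N) :=
  volume.withDensity (fun x : PhaseSpace N => ENNReal.ofReal (Real.exp (-(P.hamiltonian N x) / T)))

/-- its mass `Z`. -/
def Zmass (P : OscillatorChain) (N : ℕ) (T : ℝ) : ℝ :=
  ∫ x, Real.exp (-(P.hamiltonian N x) / T) ∂(volume : Measure (PhaseSpace N))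

/-- total current `J_tot = Σ_i j_i`. -/
def Jtot (P : OscillatorChain) (N : ℕ) : PhaseSpace N → ℝ := fun z => ∑ i : Fin N, P.bondCurrent N i z

/-- `(P_t g)(x)` for the equilibrium open kernels at temperature `T`. -/
def evolve (P : OscillatorChain) (N : ℕ) (T t : ℝ) (g : PhaseSpace N → ℝ) (x : PhaseSpace N) : ℝ :=
  ∫ y, g y ∂(P.transitionKernel N T T t.toNNReal x)

/-- `u` is an a.e.-limit of the finite-horizon correctors `∫₀^τ P_t g dt` of the observable `g`
(verbatim the hypothesis shape of the crux, with `g = J_tot`). -/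
def IsCorrectorOf (P : OscillatorChain) (N : ℕ) (T : ℝ) (g u : PhaseSpace N → ℝ) : Prop :=
  ∀ᵐ x ∂(gibbsW P N T), Tendsto (fun τ : ℝ => ∫ t in Set.Ioc (0 : ℝ) τ, evolve P N T t g x) atTop (𝓝 (u x))

/-- Shape check: the crux is literally "`IsCorrectorOf J_tot u` ⟹ `MemLp ∧ ∫u² ≤ C N² Z`". -/
theorem coneScaleCorrector_iff :
    Summit.AtomisticToContinuum.FouriersLaw.Theses.OddSectorIrreversibility.ConeScaleCorrector ↔
    (∀ ω₂ lam β γ : ℝ, 0 < ω₂ → 0 < lam → 0 < β → 0 < γ → ∀ T : ℝ, 0 < T → ∃ C : ℝ,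
      ∀ (N : ℕ) (u : PhaseSpace N → ℝ),
      IsCorrectorOf (pinnedChain ω₂ lam β γ) N T (Jtot (pinnedChain ω₂ lam β γ) N) u →
        MemLp u 2 (gibbsW (pinnedChain ω₂ lam β γ) N T) ∧
        ∫ x, (u x) ^ 2 ∂(gibbsW (pinnedChain ω₂ lam β γ) N T) ≤
          C * (N : ℝ) ^ 2 * Zmass (pinnedChain ω₂ lam β γ) N T) :=
  Iff.rfl

/-! ## The two jaws of the sandwich -/

/-- **(M) MEMORY-TIME BOUND** (load-bearing, `N`-uniform; the relative form of E1).
For every admissible parameter point and `T > 0` there are `A ≥ 0` and `B` with, for every `N` and every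
a.e.-limit `u` of the finite-horizon Kubo correctors of `J_tot`:
`u ∈ L²(μT)` and `∫ u² dμT ≤ A·N·∫ u·J_tot dμT + B·N²·Z`.
Reading: `∫u·J = ⟨u, −Lu⟩ = γT Σ_b ‖∂_{p_b}u‖² = (N−1)T²D_N·Z ≥ 0` (tap / Green–Kubo identities of `CorrectorTheory`),
so (M) says the FORECAST MEMORY TIME `τ_mem := ‖u‖²/⟨u,J⟩` is at most `A·N + B N²/⟨u,J⟩`: memory ≤ O(1) causal
crossings, with the conductance factored out (`A` an inverse speed — no `κ`, no `σ²`). Implied by E1 (take `A = 0`).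
HARMONIC MEMBER (exact Sylvester algebra, kit j013519 part A, ω₂ = γ = T = 1): `‖u‖²/N³ → 0.165`,
`⟨u,J⟩ = 0.125 (N−1)²`, `τ_mem/N = 1.22, 1.28, 1.30, 1.31` at `N = 32, 64, 96, 128` — (M) HOLDS at the integrable
point (`A ≈ 1.3`, `B ≈ 0`) although E1 fails there (exponent 3): (M) is transport-class blind, and in the skeleton
(M) ∧ (W) ⇒ E1 the anharmonicity is load-bearing in (W) alone. Conjectured family-wide (`MemoryTimeBoundAt` below,
all `lam, β ≥ 0`). -/
def MemoryTimeBound : Prop :=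
  ∀ ω₂ lam β γ : ℝ, 0 < ω₂ → 0 < lam → 0 < β → 0 < γ → ∀ T : ℝ, 0 < T → ∃ A B : ℝ, 0 ≤ A ∧
    ∀ (N : ℕ) (u : PhaseSpace N → ℝ),
    let P := pinnedChain ω₂ lam β γ
    IsCorrectorOf P N T (Jtot P N) u →
      MemLp u 2 (gibbsW P N T) ∧
      ∫ x, (u x) ^ 2 ∂(gibbsW P N T) ≤
        A * (N : ℝ) * (∫ x, u x * Jtot P N x ∂(gibbsW P N T)) + B * (N : ℝ) ^ 2 * Zmass P N T

/-- (M) at ONE parameter point `(ω₂, lam, β, γ)` (no sign constraints: `lam = β = 0` is the pinned harmonic / RLL chain).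
`MemoryTimeBound` is `∀` admissible points of `MemoryTimeBoundAt`; the harmonic instance `MemoryTimeBoundAt ω₂ 0 0 γ`
(support-sized: Gaussian algebra, one Sylvester equation, trace asymptotics) is the calibration target `A → 1.31…`. -/
def MemoryTimeBoundAt (ω₂ lam β γ : ℝ) : Prop :=
  ∀ T : ℝ, 0 < T → ∃ A B : ℝ, 0 ≤ A ∧
    ∀ (N : ℕ) (u : PhaseSpace N → ℝ),
    let P := pinnedChain ω₂ lam β γ
    IsCorrectorOf P N T (Jtot P N) u →
      MemLp u 2 (gibbsW P N T) ∧
      ∫ x, (u x) ^ 2 ∂(gibbsW P N T) ≤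
        A * (N : ℝ) * (∫ x, u x * Jtot P N x ∂(gibbsW P N T)) + B * (N : ℝ) ^ 2 * Zmass P N T

theorem memoryTimeBound_iff_forall_at :
    MemoryTimeBound ↔ ∀ ω₂ lam β γ : ℝ, 0 < ω₂ → 0 < lam → 0 < β → 0 < γ → MemoryTimeBoundAt ω₂ lam β γ :=
  Iff.rfl

/-- HARMONIC CALIBRATION ITEM (support, provable now by explicit spectral theory of the linear Langevin chain):
(M) at `lam = β = 0` for every `ω₂, γ > 0`. -/
def HarmonicMemoryTime : Prop := ∀ ω₂ γ : ℝ, 0 < ω₂ → 0 < γ → MemoryTimeBoundAt ω₂ 0 0 γ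

/-- **(W) CORRECTOR-LEVEL WITNESS BOUND** (support-level: the route's transport-witness inequality, cut one
line before `D_N` appears). For every admissible parameter point and `T > 0` there are `K₁, K₂` with, for every
`N` and every a.e.-limit corrector `u ∈ L²(μT)`:
`∫ u·J_tot dμT ≤ K₁ · ‖u‖_{L²(μT)} · √Z + K₂ · N · Z` (lead reshape: additive term at the order the
route's tap-leak bookkeeping gives).
Content (all in the route already): `⟨u,J⟩ = (N−1)s`, `2 s Σ_N − leak ≤ ⟨u⁻, W⟩ ≤ ‖u‖‖W‖` with `Σ_N ≥ a N²/32`,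
`‖W‖ ≤ c√(C₂ a)·N√Z` (E2 on dyadic shells), `leak ≤ c″√(⟨u,J⟩ Z)` (E3 + tap identity); hence
`⟨u,J⟩ ≤ (16 c √(C₂/a)) ‖u‖ √Z + (leak-constant)·N·Z`. -/
def CorrectorWitnessBound : Prop :=
  ∀ ω₂ lam β γ : ℝ, 0 < ω₂ → 0 < lam → 0 < β → 0 < γ → ∀ T : ℝ, 0 < T → ∃ K₁ K₂ : ℝ,
    ∀ (N : ℕ) (u : PhaseSpace N → ℝ),
    let P := pinnedChain ω₂ lam β γ
    IsCorrectorOf P N T (Jtot P N) u → MemLp u 2 (gibbsW P N T) →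
      ∫ x, u x * Jtot P N x ∂(gibbsW P N T) ≤
        K₁ * Real.sqrt (∫ x, (u x) ^ 2 ∂(gibbsW P N T)) * Real.sqrt (Zmass P N T) +
          K₂ * (N : ℝ) * Zmass P N T

/-- `Z ≥ 0`. -/
theorem Zmass_nonneg (P : OscillatorChain) (N : ℕ) (T : ℝ) : 0 ≤ Zmass P N T :=
  integral_nonneg fun _ => (Real.exp_pos _).le

/-- The real-variable core of the bootstrap: `x² ≤ a·x + b` with `0 ≤ b` forces `x² ≤ a² + 2b`. -/
theorem sq_le_of_sq_le_mul_add {x a b : ℝ} (h : x ^ 2 ≤ a * x + b) : x ^ 2 ≤ a ^ 2 + 2 * b := by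
  nlinarith [sq_nonneg (x - a), sq_abs a, sq_nonneg (|x| - |a|), abs_mul_abs_self x, abs_nonneg x,
    abs_nonneg a, le_abs_self (a * x), abs_mul a x]

/-- **BOOTSTRAP GLUE (the first lemma of the line, PROVED).** The memory-time bound (M) and the corrector-level
witness bound (W) imply the crux `ConeScaleCorrector` (its `Iff.rfl`-unfolding; the named conclusion is `ConeScaleCorrector_of` below), with `C = A²K₁² + 2(|A K₂| + |B|)`:
`‖u‖² ≤ A N (K₁‖u‖√Z + K₂ N Z) + B N² Z` is a quadratic inequality in `‖u‖` whose solution is `‖u‖ ≲ N √Z`.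
No `N`-uniform input hides here. -/
theorem bootstrapGlue (hM : MemoryTimeBound) (hW : CorrectorWitnessBound) :
    (∀ ω₂ lam β γ : ℝ, 0 < ω₂ → 0 < lam → 0 < β → 0 < γ → ∀ T : ℝ, 0 < T → ∃ C : ℝ,
      ∀ (N : ℕ) (u : PhaseSpace N → ℝ),
      IsCorrectorOf (pinnedChain ω₂ lam β γ) N T (Jtot (pinnedChain ω₂ lam β γ) N) u →
        MemLp u 2 (gibbsW (pinnedChain ω₂ lam β γ) N T) ∧
        ∫ x, (u x) ^ 2 ∂(gibbsW (pinnedChain ω₂ lam β γ) N T) ≤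
          C * (N : ℝ) ^ 2 * Zmass (pinnedChain ω₂ lam β γ) N T) := by
  intro ω₂ lam β γ hω hl hβ hγ T hT
  obtain ⟨A, B, hA, hM'⟩ := hM ω₂ lam β γ hω hl hβ hγ T hT
  obtain ⟨K₁, K₂, hW'⟩ := hW ω₂ lam β γ hω hl hβ hγ T hT
  refine ⟨A ^ 2 * K₁ ^ 2 + 2 * (|A * K₂| + |B|), fun N u hu => ?_⟩
  obtain ⟨hmem, hineq⟩ := hM' N u hu
  have hw := hW' N u hu hmem
  refine ⟨hmem, ?_⟩
  set P := pinnedChain ω₂ lam β γ with hP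
  set I := ∫ x, (u x) ^ 2 ∂(gibbsW P N T) with hI
  set G := ∫ x, u x * Jtot P N x ∂(gibbsW P N T) with hG
  set z := Zmass P N T with hz
  have hz0 : 0 ≤ z := Zmass_nonneg P N T
  have hI0 : 0 ≤ I := integral_nonneg fun _ => sq_nonneg _
  have hN0 : (0 : ℝ) ≤ N := Nat.cast_nonneg N
  have hNN : (N : ℝ) ≤ (N : ℝ) ^ 2 := by
    rcases Nat.eq_zero_or_pos N with h0 | hpos
    · simp [h0]
    · have h1 : (1 : ℝ) ≤ N := by exact_mod_cast hpos
      nlinarith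
  -- x := ‖u‖, with x² = I
  set x := Real.sqrt I with hx
  have hxI : x ^ 2 = I := Real.sq_sqrt hI0
  have hsz : Real.sqrt z ^ 2 = z := Real.sq_sqrt hz0
  -- chain (M) and (W): I ≤ A N (K₁ x √z + K₂ N z) + B N² z
  have h1 : I ≤ A * N * (K₁ * x * Real.sqrt z + K₂ * N * z) + B * (N : ℝ) ^ 2 * z := by
    have hAN : 0 ≤ A * N := mul_nonneg hA hN0
    have := mul_le_mul_of_nonneg_left hw hAN
    linarith
  -- take absolute values of the constants
  have h2 : I ≤ (A * N * K₁ * Real.sqrt z) * x + (|A * K₂| + |B|) * (N : ℝ) ^ 2 * z := by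
    have e1 : A * N * (K₁ * x * Real.sqrt z + K₂ * N * z) =
        (A * N * K₁ * Real.sqrt z) * x + (A * K₂) * (N : ℝ) ^ 2 * z := by
      ring
    rw [e1] at h1
    have h3 : (A * K₂) * (N : ℝ) ^ 2 * z ≤ |A * K₂| * (N : ℝ) ^ 2 * z := by
      apply mul_le_mul_of_nonneg_right _ hz0
      exact mul_le_mul_of_nonneg_right (le_abs_self _) (by positivity)
    have h4 : B * (N : ℝ) ^ 2 * z ≤ |B| * (N : ℝ) ^ 2 * z := by
      apply mul_le_mul_of_nonneg_right _ hz0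
      exact mul_le_mul_of_nonneg_right (le_abs_self _) (by positivity)
    nlinarith
  -- quadratic inequality in x
  rw [← hxI] at h2
  have h5 := sq_le_of_sq_le_mul_add h2
  rw [hxI] at h5
  have e2 : (A * N * K₁ * Real.sqrt z) ^ 2 = A ^ 2 * K₁ ^ 2 * (N : ℝ) ^ 2 * z := by
    rw [show (A * N * K₁ * Real.sqrt z) ^ 2 = A ^ 2 * K₁ ^ 2 * (N : ℝ) ^ 2 * Real.sqrt z ^ 2 by ring, hsz]
  rw [e2] at h5
  have e3 : A ^ 2 * K₁ ^ 2 * (N : ℝ) ^ 2 * z + 2 * ((|A * K₂| + |B|) * (N : ℝ) ^ 2 * z) =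
      (A ^ 2 * K₁ ^ 2 + 2 * (|A * K₂| + |B|)) * (N : ℝ) ^ 2 * z := by ring
  linarith [e3]

/-! ## The Dirichlet-form reading of (M) -/

/-- **CONTACT POINCARÉ** (equivalent to (M) by the tap identity `γT(‖∂_{p_0}u‖² + ‖∂_{p_{N−1}}u‖²) = ∫u·J`,
`CorrectorTheory` A(6)): a Poincaré inequality for the ONE function `u` using only the two CONTACT momentum
derivatives, with constant `A·N·γT` and an additive cone budget `B N² Z`. For a generic function of `2N`
variables such an inequality is absurd; for the corrector it says "every forecastable unit of transport is
visible at the contacts at rate ≥ 1/(A N)" — no boundary-dark forecasts. (The symmetric part of `−L` has the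
hugely degenerate Dirichlet form `γTΣ_b‖∂_{p_b}·‖²`; (M) is its coercivity at scale `1/N` on ONE vector.) -/
def ContactPoincare : Prop :=
  ∀ ω₂ lam β γ : ℝ, 0 < ω₂ → 0 < lam → 0 < β → 0 < γ → ∀ T : ℝ, 0 < T → ∃ A B : ℝ, 0 ≤ A ∧
    ∀ (N : ℕ) (b₀ b₁ : Fin N), b₀.val = 0 → b₁.val = N - 1 → ∀ (u : PhaseSpace N → ℝ),
    let P := pinnedChain ω₂ lam β γ
    IsCorrectorOf P N T (Jtot P N) u →
      MemLp u 2 (gibbsW P N T) ∧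
      ∫ x, (u x) ^ 2 ∂(gibbsW P N T) ≤
        A * (N : ℝ) * (γ * T * ((∫ x, (partialP b₀ u x) ^ 2 ∂(gibbsW P N T)) +
          ∫ x, (partialP b₁ u x) ^ 2 ∂(gibbsW P N T))) + B * (N : ℝ) ^ 2 * Zmass P N T

/-- **(M_β) the tolerance of the bootstrap**: any member `∫u² ≤ A N^{2−β} ⟨u,J⟩^β Z^{1−β} + B N² Z` with
`0 < β < 2` (and `⟨u,J⟩ ≥ 0`) closes the same way (`x² ≲ N^{2−β}(K₁x√Z + K₂Z)^β Z^{1−β}` forces `x ≲ N√Z`);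
`β = 1` is (M). Stated for the record; only `β = 1` is proposed as the stub. -/
def MemoryTimeBoundPow (βe : ℝ) : Prop :=
  ∀ ω₂ lam β γ : ℝ, 0 < ω₂ → 0 < lam → 0 < β → 0 < γ → ∀ T : ℝ, 0 < T → ∃ A B : ℝ, 0 ≤ A ∧
    ∀ (N : ℕ) (u : PhaseSpace N → ℝ),
    let P := pinnedChain ω₂ lam β γ
    IsCorrectorOf P N T (Jtot P N) u →
      MemLp u 2 (gibbsW P N T) ∧ 0 ≤ ∫ x, u x * Jtot P N x ∂(gibbsW P N T) ∧
      ∫ x, (u x) ^ 2 ∂(gibbsW P N T) ≤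
        A * (N : ℝ) ^ (2 - βe) * (∫ x, u x * Jtot P N x ∂(gibbsW P N T)) ^ βe * (Zmass P N T) ^ (1 - βe)
          + B * (N : ℝ) ^ 2 * Zmass P N T


/-! ## Bridges and the crux by name -/

theorem memoryTimeBound_of_stub : MemoryTimeBound :=
  fun ω₂ lam β γ hω hl hβ hγ T hT => stub_memoryTimeBound ω₂ lam β γ hω hl hβ hγ T hT

theorem correctorWitnessBound_of_stub : CorrectorWitnessBound :=
  fun ω₂ lam β γ hω hl hβ hγ T hT => stub_correctorWitnessBound ω₂ lam β γ hω hl hβ hγ T hT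

/-- **`ConeScaleCorrector_of`**: the registered stubs (M), P, E2 imply the route decl
`Summit.AtomisticToContinuum.FouriersLaw.Theses.OddSectorIrreversibility.ConeScaleCorrector` BY NAME. -/
theorem ConeScaleCorrector_of :
    Summit.AtomisticToContinuum.FouriersLaw.Theses.OddSectorIrreversibility.ConeScaleCorrector :=
  coneScaleCorrector_iff.mpr (bootstrapGlue memoryTimeBound_of_stub correctorWitnessBound_of_stub)

end Summit.AtomisticToContinuum.FouriersLaw.Theorems.OddSectorIrreversibility.MemoryTime
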